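import Literature.Computability.Cryptography.ChenQuantumLWEGeneratingRows

/-!
# Chen's parameter conditions put the digit cap in its informative regime (T27: census §35)

REPRODUCTION / ANALYSIS OF A CLAIMED RESULT UNDER ADJUDICATION (withdrawn): Yilei Chen, *Quantum
Algorithms for Lattice Problems*, IACR ePrint 2024/555, version of 2024-04-18 [ChenQuantumLattice2024]
(the version carrying the author's note that Step 9 contains a bug), §3.3 "Parameters and conditions"
(printed pp. 18–20): Cond. **C.1** `t² = cu²`, `t/u = √c ∈ (64 log³n, 65 log³n)`; Cond. **C.2**
`M = 2(t² + u²)` with the Gram–Schmidt length of the last basis vector equal to `D‖b‖ = u`; Cond. **C.3**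
`M/(2D²) = (c+1)‖b‖² = p₁p₂⋯p_κ` (`=: N = p₁·Q`, `Q = p₂⋯p_κ`); Cond. **C.4** `2r log n < Dq/(log n)²`
("the only constraint on q"); the setting `r = ut³/(4 log n)` made in the discussion of Cond. **C.7**
(p. 19); and **Lemma 3.6 (3)** (printed p. 17): `‖b‖² ∈ 1 + 4p₁²(p₂² + … + p_κ²) + [0.04, 0.27]·4p₁²β²(n − κ)`
for the planted vector `b = [−1, 2p₁sᵀ, 2p₁eᵀ]ᵀ` of eq. (12), `β ≥ 2`, `κ ∈ O(log n)`.  Bundle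
`papers/QuantumAdvantage/lwe-quantum-autopsy/`, Part 2 (`REPAIR-CENSUS.md` §24.3, §31.2 (REFEREE R-63.4),
§32.2 (2), §34.2 (2), §35; theorem **T27**; census row G7).  HONEST FRAMING: kernel-checked REAL
ARITHMETIC — the two "instance inequalities" that the census derived BY HAND from Chen's printed
parameter conditions, and their consequence that the kernel cap of T21/T25 on every instance-aware
digit observer is informative at Chen's sizes; the hypotheses are TRANSCRIPTIONS of the printed
conditions (each named after the condition it transcribes), the conclusions are elementary consequences;
NOT summit progress, no cryptanalytic claim in either direction, no new algorithm, no hardness claim;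
quantum lower bounds are out of scope.

## Dictionary

All quantities are real numbers: `L = log n` (`L ≥ 1`; the base of the logarithm is immaterial),
`D` the line-coarsening factor (`D ≥ 1`), `u`, `t`, `r`, `M`, `q` as in C.1–C.7, `normb = ‖b‖₂`,
`N = M/(2D²) = p₁Q` the register modulus divided by `D²` (census notation; T24's `N`), `p₁ ≥ 1`,
`Q ≥ 1`, `β ≥ 2` the error width, `κ` the number of special primes, `S₂ = p₂² + … + p_κ² ≥ 0`.
On the tree side `b : Fin (n+1) → ℤ` (so `n + 1` coordinates = Chen's `n`), `‖b‖₁ = Σ|b_i|`,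
`‖b‖₂² = Σ b_i²`; Lemma 3.6 (3) is transcribed with `n + 1 − κ` and the smallness `2κ ≤ n + 1` of the
number of special primes (`κ ∈ O(log n)`, p. 17) is an explicit hypothesis.

## What is proved

* `modulus_bound_of_conditions` (**I1**, census §24.3 / §32.2 (2)): C.1, C.2, C.3, C.4 and
  `r = ut³/(4 log n)` give `31·D²·log⁵n · D·N·‖b‖₂² < q` — T24's hypothesis `hq` of
  `cap_regime_of_norm_bound` with `K = 31D²log⁵n` (the census's `q ≥ 31·D³N‖b‖₂²·log⁵n`).
* `sqrt_card_lt_of_lemma36` (**I2**, census §32.2 (2)): Lemma 3.6 (3) with `β ≥ 2`, `p₁ ≥ 1`,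
  `2κ ≤ n + 1` gives `√(n+1) < 31·D²·log⁵n·‖b‖₂` — T24's hypothesis `hK`.
* `cap_regime_of_conditions`: hence, for the planted vector `b` itself, `D·N·‖b‖₁ < q` and
  `D·p₁·(Q+1)·‖b‖₁ < 2q` — by T24's `cap_lt_one_iff` the cap `1/Q + Dp₁(Q²−1)‖b‖₁/(2Qq)` of
  T21 (e) / T25 (`chenCheckBoxDigitObserver_le_centred_all`) is `< 1` at Chen's sizes, with no
  by-hand arithmetic left between the printed conditions and that statement.
* `shift_ratio_lt_of_conditions` (census §34.2 (2), REFEREE R-67.1's premise): `D·N·‖b‖₂ / q <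
  1/(31·D²·log⁵n·‖b‖₂)` — the bound behind "every centred hidden shift has `|s_{k,i}| ≤ q`".
-/

namespace Literature.Computability.Cryptography.Chen2024

open scoped BigOperators
open Finset

section ParameterRegime

/-- **(I1) The modulus bound from C.1–C.4 and the setting of `r`.**  With `L = log n ≥ 1`, `D > 0`,
`u, t > 0`: C.1 (`t/u = √c > 64 log³n`), C.2 (`u = D‖b‖`, `M = 2(t²+u²)`), C.3 (`M/(2D²) = N`),
C.4 (`2r log n < Dq/log²n`) and `r = ut³/(4 log n)` (C.7, p. 19) give
`31·D²L⁵ · D · N · ‖b‖² < q`.  Proof: `q > 2rL³/D = ut³L²/(2D)`, `ND² = t² + u²`, and with `s = t/u`,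
`62L³(s² + 1) < s³` because `s > 64L³ ≥ 64`.  Census §24.3 ("`q/(DN) ≥ 31·D²‖b‖²log⁵n`").
[cite: ChenQuantumLattice2024, §3.3 pp. 18–20 (Cond. C.1, C.2, C.3, C.4, C.7); census §24.3, §32.2, §35] -/
theorem modulus_bound_of_conditions {L D u t r q M N normb : ℝ} (hL : 1 ≤ L) (hD : 0 < D)
    (hu : 0 < u) (ht : 0 < t)
    (hC1 : 64 * L ^ 3 < t / u)
    (hC2u : u = D * normb) (hC2M : M = 2 * (t ^ 2 + u ^ 2))
    (hC3 : M / (2 * D ^ 2) = N)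
    (hC4 : 2 * r * L < D * q / L ^ 2)
    (hC7 : r = u * t ^ 3 / (4 * L)) :
    31 * D ^ 2 * L ^ 5 * D * N * normb ^ 2 < q := by
  have hL0 : 0 < L := by linarith
  have hL3 : 1 ≤ L ^ 3 := one_le_pow₀ hL
  -- C.1 multiplied out
  have hs : 64 * L ^ 3 * u < t := by rwa [lt_div_iff₀ hu] at hC1
  -- C.2/C.3: `N·D² = t² + u²`
  have hND : N * D ^ 2 = t ^ 2 + u ^ 2 := by
    rw [← hC3, hC2M]; field_simp
  -- C.2: `normb = u/D`
  have hnormb : normb * D = u := by rw [hC2u]; ring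
  -- C.4 with the setting of `r`: `L²ut³ < 2Dq`
  have hq : L ^ 2 * u * t ^ 3 < 2 * D * q := by
    rw [hC7] at hC4
    have h1 : 2 * (u * t ^ 3 / (4 * L)) * L = u * t ^ 3 / 2 := by field_simp; ring
    rw [h1, lt_div_iff₀ (by positivity)] at hC4
    nlinarith [hC4]
  -- the polynomial heart: `62L³·u(t² + u²) < t³`
  have h64 : 64 * u < t := lt_of_le_of_lt (by nlinarith [hL3, hu.le]) hs
  have ht2 : 31 * u ^ 2 ≤ t ^ 2 := by
    nlinarith [mul_lt_mul'' h64 h64 (by positivity) (by positivity), sq_nonneg u]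
  have hLu : 0 < L ^ 3 * u := by positivity
  have hkey : 62 * L ^ 3 * (u * (t ^ 2 + u ^ 2)) < t ^ 3 := by
    have h1 : 64 * L ^ 3 * u * t ^ 2 < t * t ^ 2 := mul_lt_mul_of_pos_right hs (by positivity)
    nlinarith [h1, mul_le_mul_of_nonneg_left ht2 hLu.le]
  -- assemble: the left side equals `31L⁵u²(t²+u²)/D`
  have hlhs : 31 * D ^ 2 * L ^ 5 * D * N * normb ^ 2 * D = 31 * L ^ 5 * u ^ 2 * (t ^ 2 + u ^ 2) := by
    have : 31 * D ^ 2 * L ^ 5 * D * N * normb ^ 2 * D = 31 * L ^ 5 * (normb * D) ^ 2 * (N * D ^ 2) := by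
      ring
    rw [this, hnormb, hND]
  have hmid : 31 * L ^ 5 * u ^ 2 * (t ^ 2 + u ^ 2) * 2 < L ^ 2 * u * t ^ 3 := by
    have : 31 * L ^ 5 * u ^ 2 * (t ^ 2 + u ^ 2) * 2 = L ^ 2 * u * (62 * L ^ 3 * (u * (t ^ 2 + u ^ 2))) := by
      ring
    rw [this]
    exact mul_lt_mul_of_pos_left hkey (by positivity)
  -- `lhs · D · 2 < L²ut³ < 2Dq`
  have h2D : 31 * D ^ 2 * L ^ 5 * D * N * normb ^ 2 * (2 * D) < q * (2 * D) := by
    calc 31 * D ^ 2 * L ^ 5 * D * N * normb ^ 2 * (2 * D)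
        = 31 * L ^ 5 * u ^ 2 * (t ^ 2 + u ^ 2) * 2 := by rw [← hlhs]; ring
      _ < L ^ 2 * u * t ^ 3 := hmid
      _ < 2 * D * q := hq
      _ = q * (2 * D) := by ring
  exact lt_of_mul_lt_mul_right h2D (by positivity)

/-- (I1) in the `≤` form consumed by `cap_regime_of_norm_bound` (`hq : K·D·N·B₂² ≤ q`, `K = 31D²L⁵`).
[cite: ChenQuantumLattice2024, §3.3 pp. 18–20 (Cond. C.1–C.4, C.7); census §32.2, §35] -/
theorem modulus_bound_of_conditions_le {L D u t r q M N normb : ℝ} (hL : 1 ≤ L) (hD : 0 < D)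
    (hu : 0 < u) (ht : 0 < t) (hC1 : 64 * L ^ 3 < t / u) (hC2u : u = D * normb)
    (hC2M : M = 2 * (t ^ 2 + u ^ 2)) (hC3 : M / (2 * D ^ 2) = N) (hC4 : 2 * r * L < D * q / L ^ 2)
    (hC7 : r = u * t ^ 3 / (4 * L)) :
    31 * D ^ 2 * L ^ 5 * D * N * normb ^ 2 ≤ q :=
  (modulus_bound_of_conditions hL hD hu ht hC1 hC2u hC2M hC3 hC4 hC7).le

/-- **(I2) The dimension bound from Lemma 3.6 (3).**  If `‖b‖² = 1 + 4p₁²S₂ + θ·4p₁²β²(n+1−κ)` for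
some `θ ∈ [0.04, 0.27]` (Lemma 3.6 (3), `S₂ = p₂² + … + p_κ² ≥ 0`, here with `n + 1` coordinates),
`β ≥ 2`, `p₁ ≥ 1`, `2κ ≤ n + 1`, `D ≥ 1`, `L ≥ 1`, then `√(n+1) < 31·D²·L⁵·‖b‖₂`: indeed
`‖b‖² ≥ 1 + 0.64(n+1−κ) ≥ 1 + 0.32(n+1)` and `961(1 + 0.32(n+1)) > n + 1`.  Census §32.2 (2)
("`‖b‖ ≥ 0.8p₁√(ℓ(n−κ))`").
[cite: ChenQuantumLattice2024, Lemma 3.6 p. 17, §3.2 p. 17 (κ ∈ O(log n)); census §32.2, §35] -/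
theorem sqrt_card_lt_of_lemma36 {n : ℕ} {L D p₁ S₂ β κ normb : ℝ} (hL : 1 ≤ L) (hD : 1 ≤ D)
    (hp : 1 ≤ p₁) (hβ : 2 ≤ β) (hS₂ : 0 ≤ S₂) (hκ : 2 * κ ≤ (n + 1 : ℝ)) (hnormb : 0 ≤ normb)
    (h36 : ∃ θ : ℝ, 0.04 ≤ θ ∧ θ ≤ 0.27 ∧
      normb ^ 2 = 1 + 4 * p₁ ^ 2 * S₂ + θ * (4 * p₁ ^ 2 * β ^ 2 * ((n + 1 : ℝ) - κ))) :
    Real.sqrt (n + 1 : ℝ) < 31 * D ^ 2 * L ^ 5 * normb := by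
  obtain ⟨θ, hθ, -, hsq⟩ := h36
  have hn : (0 : ℝ) ≤ (n : ℝ) := Nat.cast_nonneg n
  have hnk : ((n : ℝ) + 1) / 2 ≤ (n + 1 : ℝ) - κ := by linarith
  have hp2 : 1 ≤ p₁ ^ 2 := one_le_pow₀ hp
  have hβ2 : 4 ≤ β ^ 2 := by nlinarith
  -- `‖b‖² ≥ 1 + 0.32(n+1)`
  have hlow : 1 + 0.32 * ((n : ℝ) + 1) ≤ normb ^ 2 := by
    have h1 : 4 * ((n + 1 : ℝ) - κ) ≤ p₁ ^ 2 * β ^ 2 * ((n + 1 : ℝ) - κ) := by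
      have : (4 : ℝ) ≤ p₁ ^ 2 * β ^ 2 := by nlinarith
      exact mul_le_mul_of_nonneg_right this (by linarith)
    have h2 : 0 ≤ 4 * p₁ ^ 2 * S₂ := by positivity
    nlinarith [h1, h2, hθ]
  have hpos : 0 < normb := by
    rcases eq_or_lt_of_le hnormb with h0 | h0
    · rw [← h0] at hlow; norm_num at hlow; linarith
    · exact h0
  have hDL : 1 ≤ D ^ 2 * L ^ 5 := one_le_mul_of_one_le_of_one_le (one_le_pow₀ hD) (one_le_pow₀ hL)
  rw [Real.sqrt_lt' (by positivity)]
  -- `(31D²L⁵‖b‖)² ≥ 961‖b‖² ≥ 961(1 + 0.32(n+1)) > n + 1`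
  have h961 : 961 * normb ^ 2 ≤ (31 * D ^ 2 * L ^ 5 * normb) ^ 2 := by
    have : (31 * D ^ 2 * L ^ 5 * normb) ^ 2 = 961 * normb ^ 2 * (D ^ 2 * L ^ 5) ^ 2 := by ring
    rw [this]
    have h1 : 1 ≤ (D ^ 2 * L ^ 5) ^ 2 := one_le_pow₀ hDL
    nlinarith [sq_nonneg normb]
  nlinarith [hlow, h961]

/-- **The informative regime from the printed conditions.**  For the planted vector `b` on `n + 1`
coordinates with `‖b‖₂ = √(Σ b_i²)`, C.1–C.4 with `r = ut³/(4 log n)` and Lemma 3.6 (3) (`β ≥ 2`,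
`p₁ ≥ 1`, `2κ ≤ n+1`, `D ≥ 1`, `L = log n ≥ 1`) give `D·N·‖b‖₁ < q`; with `N = p₁Q`, `Q ≥ 1`, hence
`D·p₁·(Q+1)·‖b‖₁ < 2q` — the right-hand side of T24's `cap_lt_one_iff`: the cap
`1/Q + Dp₁(Q²−1)‖b‖₁/(2Qq)` of T21 (e) / T25 on every digit observer is `< 1`.  Assembled from
(I1), (I2), `l1_le_sqrt_card_mul_l2`, `cap_regime_of_norm_bound`, `cap_regime_of_DN` (T24).
[cite: ChenQuantumLattice2024, §3.3 pp. 18–20 (Cond. C.1–C.4, C.7), Lemma 3.6 p. 17, eq. (12) p. 17; census §31.2, §32.2, §35] -/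
theorem cap_regime_of_conditions {n : ℕ} (b : Fin (n + 1) → ℤ)
    {L D u t r q M N p₁ Q S₂ β κ : ℝ} (hL : 1 ≤ L) (hD : 1 ≤ D) (hu : 0 < u) (ht : 0 < t)
    (hp : 1 ≤ p₁) (hQ : 1 ≤ Q) (hβ : 2 ≤ β) (hS₂ : 0 ≤ S₂) (hκ : 2 * κ ≤ (n + 1 : ℝ))
    (hC1 : 64 * L ^ 3 < t / u)
    (hC2u : u = D * Real.sqrt (∑ i, ((b i : ℤ) : ℝ) ^ 2)) (hC2M : M = 2 * (t ^ 2 + u ^ 2))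
    (hC3 : M / (2 * D ^ 2) = N) (hC3' : N = p₁ * Q)
    (hC4 : 2 * r * L < D * q / L ^ 2) (hC7 : r = u * t ^ 3 / (4 * L))
    (h36 : ∃ θ : ℝ, 0.04 ≤ θ ∧ θ ≤ 0.27 ∧ (∑ i, ((b i : ℤ) : ℝ) ^ 2) =
      1 + 4 * p₁ ^ 2 * S₂ + θ * (4 * p₁ ^ 2 * β ^ 2 * ((n + 1 : ℝ) - κ))) :
    D * N * (∑ i, ((b i).natAbs : ℝ)) < q ∧ D * p₁ * (Q + 1) * (∑ i, ((b i).natAbs : ℝ)) < 2 * q := by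
  set normb : ℝ := Real.sqrt (∑ i, ((b i : ℤ) : ℝ) ^ 2) with hnormb_def
  have hsum : 0 ≤ ∑ i, ((b i : ℤ) : ℝ) ^ 2 := sum_nonneg fun i _ => sq_nonneg _
  have hnb0 : 0 ≤ normb := Real.sqrt_nonneg _
  have hnb2 : normb ^ 2 = ∑ i, ((b i : ℤ) : ℝ) ^ 2 := Real.sq_sqrt hsum
  have hD0 : 0 < D := by linarith
  have h36' : ∃ θ : ℝ, 0.04 ≤ θ ∧ θ ≤ 0.27 ∧
      normb ^ 2 = 1 + 4 * p₁ ^ 2 * S₂ + θ * (4 * p₁ ^ 2 * β ^ 2 * ((n + 1 : ℝ) - κ)) := by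
    rw [hnb2]; exact h36
  have hI1 := modulus_bound_of_conditions_le hL hD0 hu ht hC1 hC2u hC2M hC3 hC4 hC7
  have hI2 := sqrt_card_lt_of_lemma36 hL hD hp hβ hS₂ hκ hnb0 h36'
  have hN : 0 < N := by rw [hC3']; nlinarith
  have hreg : D * N * (∑ i, ((b i).natAbs : ℝ)) < q :=
    cap_regime_of_norm_bound (K := 31 * D ^ 2 * L ^ 5) hD0 hN hnb0 (Real.sqrt_nonneg _)
      (l1_le_sqrt_card_mul_l2 b) hI2 (by simpa [mul_assoc, mul_comm, mul_left_comm] using hI1)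
  refine ⟨hreg, ?_⟩
  exact cap_regime_of_DN hC3' hQ hD0.le (by linarith) (sum_nonneg fun i _ => Nat.cast_nonneg _) hreg

/-- **The hidden shifts are small** (census §34.2 (2), the premise of REFEREE R-67.1 refined): under
C.1–C.4 with `r = ut³/(4 log n)` and `‖b‖₂ > 0`, `D·N·‖b‖₂/q < 1/(31·D²·log⁵n·‖b‖₂)`; since every
centred hidden shift has `|s_{k,i}| ≤ Dp₁(Q−1)‖b‖_∞ < D·N·‖b‖₂`, all of them are `< q` at Chen's
sizes (so T25's per-coordinate exit counts are exact there).
[cite: ChenQuantumLattice2024, §3.3 pp. 18–20 (Cond. C.1–C.4, C.7); census §34.2 (2), §35] -/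
theorem shift_ratio_lt_of_conditions {L D u t r q M N normb : ℝ} (hL : 1 ≤ L) (hD : 0 < D)
    (hu : 0 < u) (ht : 0 < t) (hC1 : 64 * L ^ 3 < t / u) (hC2u : u = D * normb)
    (hC2M : M = 2 * (t ^ 2 + u ^ 2)) (hC3 : M / (2 * D ^ 2) = N) (hC4 : 2 * r * L < D * q / L ^ 2)
    (hC7 : r = u * t ^ 3 / (4 * L)) :
    D * N * normb / q < 1 / (31 * D ^ 2 * L ^ 5 * normb) := by
  have hI1 := modulus_bound_of_conditions hL hD hu ht hC1 hC2u hC2M hC3 hC4 hC7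
  have hnormb : 0 < normb := by
    have h : normb = u / D := by rw [hC2u]; field_simp
    rw [h]; positivity
  have hND : N * D ^ 2 = t ^ 2 + u ^ 2 := by
    rw [← hC3, hC2M]; field_simp
  have hN : 0 < N := by nlinarith [hND, mul_pos ht ht, mul_pos hu hu, sq_nonneg D]
  have hq0 : 0 < q := lt_of_le_of_lt (by positivity) hI1
  have hK0 : 0 < 31 * D ^ 2 * L ^ 5 * normb := by positivity
  rw [div_lt_iff₀ hq0, div_mul_eq_mul_div, one_mul, lt_div_iff₀ hK0]
  calc D * N * normb * (31 * D ^ 2 * L ^ 5 * normb) = 31 * D ^ 2 * L ^ 5 * D * N * normb ^ 2 := by ring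
    _ < q := hI1

/-- **The hypothesis list is satisfiable** (guard against vacuity): toy values `n + 1 = 1`, `b = (2)`,
`L = D = p₁ = 1`, `u = ‖b‖₂ = 2`, `t = 130`, `M = 33808`, `N = Q = 16904`, `r = 1098500`,
`q = 2197001`, `β = 2`, `S₂ = κ = 0`, `θ = 3/16` satisfy every hypothesis of `cap_regime_of_conditions`
(they are NOT Chen's sizes — only a consistency witness for the transcription). [folklore] -/
theorem regime_hypotheses_satisfiable :
    ∃ (b : Fin (0 + 1) → ℤ) (L D u t r q M N p₁ Q S₂ β κ : ℝ),
      1 ≤ L ∧ 1 ≤ D ∧ 0 < u ∧ 0 < t ∧ 1 ≤ p₁ ∧ 1 ≤ Q ∧ 2 ≤ β ∧ 0 ≤ S₂ ∧ 2 * κ ≤ ((0 : ℕ) + 1 : ℝ) ∧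
      64 * L ^ 3 < t / u ∧ u = D * Real.sqrt (∑ i, ((b i : ℤ) : ℝ) ^ 2) ∧
      M = 2 * (t ^ 2 + u ^ 2) ∧ M / (2 * D ^ 2) = N ∧ N = p₁ * Q ∧
      2 * r * L < D * q / L ^ 2 ∧ r = u * t ^ 3 / (4 * L) ∧
      (∃ θ : ℝ, 0.04 ≤ θ ∧ θ ≤ 0.27 ∧ (∑ i, ((b i : ℤ) : ℝ) ^ 2) =
        1 + 4 * p₁ ^ 2 * S₂ + θ * (4 * p₁ ^ 2 * β ^ 2 * (((0 : ℕ) + 1 : ℝ) - κ))) := by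
  have hsum : (∑ i : Fin (0 + 1), (((![2] : Fin (0 + 1) → ℤ) i : ℤ) : ℝ) ^ 2) = 4 := by
    simp; norm_num
  have hsqrt : Real.sqrt (∑ i : Fin (0 + 1), (((![2] : Fin (0 + 1) → ℤ) i : ℤ) : ℝ) ^ 2) = 2 := by
    rw [hsum, show (4 : ℝ) = 2 ^ 2 by norm_num, Real.sqrt_sq (by norm_num)]
  refine ⟨![2], 1, 1, 2, 130, 1098500, 2197001, 33808, 16904, 1, 16904, 0, 2, 0, ?_⟩
  refine ⟨le_rfl, le_rfl, by norm_num, by norm_num, le_rfl, by norm_num, le_rfl, le_rfl, by norm_num,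
    by norm_num, by rw [hsqrt]; norm_num, by norm_num, by norm_num, by norm_num, by norm_num, by norm_num,
    ⟨3 / 16, by norm_num, by norm_num, by rw [hsum]; norm_num⟩⟩

end ParameterRegime

end Literature.Computability.Cryptography.Chen2024
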